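import Summits.HodgeConjecture.HodgeConjecture.Theorems.EndoscopicMiddleDegreeEnvelopedOfThetaSpan
import Literature.AlgebraicGeometry.HodgeTheory.HardLefschetzHodgeRiemannHolds
import Literature.AlgebraicGeometry.HodgeTheory.SupportedClassesHodgeConiveauHolds

/-!
# Route `EndoscopicMiddleDegree` — support item `EnvelopedOfThetaSpan` (stmt-HodgeConjecture-14732), closed

The tree theorem `envelopedOfThetaSpan_of_kaehlerPackage`
(`Theorems/EndoscopicMiddleDegreeEnvelopedOfThetaSpan.lean`) proves the item CONDITIONALLY on the two
Literature named facts `Grothendieck1969_supportedClasses_le_hodgeConiveau` (supported classes lie in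
the Hodge coniveau) and `hardLefschetz_hodgeRiemann` (the Kähler package of the hyperplane class).  Both
facts are now DISCHARGED in the Literature library —
`Grothendieck1969_supportedClasses_le_hodgeConiveau_holds` (`SupportedClassesHodgeConiveauHolds`, from
Deligne Hodge III 8.2.7/8.2.8) and `hardLefschetz_hodgeRiemann_holds` (`HardLefschetzHodgeRiemannHolds`,
Voisin I Thm. 6.25/6.32 via the Fubini–Study class) — so the item closes unconditionally.
No definition, no named-fact hypothesis, no sorry.
-/

set_option linter.dupNamespace false

noncomputable section

namespace Summit.HodgeConjecture.HodgeConjecture.Theorems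

open Literature.AlgebraicGeometry.HodgeTheory

/-- **Item stmt-HodgeConjecture-14732 (`EnvelopedOfThetaSpan`, route `EndoscopicMiddleDegree`)**,
unconditionally: `MiddleThetaSpan → OrthogonalEnveloped` — if the theta span exhausts the rational Hodge
`(n,n)`-classes, the theta-orthogonal kernel is zero (Lefschetz step + perfect pairing + Hodge–Riemann
anisotropy, all tree theorems now) and the zero class is enveloped by the zero correspondence.  The type
is literally the route decl `Summit.HodgeConjecture.HodgeConjecture.Theses.EndoscopicMiddleDegree.EnvelopedOfThetaSpan`.
[cite: VoisinHodgeI2002, Thm. 6.25 and Thm. 6.32] [cite: GrothendieckTopology1969, p. 299 (∗) and p. 300]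
[cite: BrosnanFangNiePearlstein2009, §6 (6.1)] -/
theorem endoscopicMiddleDegree_envelopedOfThetaSpan_proof :
    Summit.HodgeConjecture.HodgeConjecture.Theses.EndoscopicMiddleDegree.EnvelopedOfThetaSpan :=
  envelopedOfThetaSpan_of_kaehlerPackage Grothendieck1969_supportedClasses_le_hodgeConiveau_holds
    fun _ _ => hardLefschetz_hodgeRiemann_holds

end Summit.HodgeConjecture.HodgeConjecture.Theorems

end
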